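import Mathlib
import HarnessLib

/-!
# Walks in one-point unions of graphs and along attached paths (the graph-theoretic steps of
# Charikar–Makarychev–Makarychev's multicut construction, CMM10 Theorem 3.3)

[topic Combinatorics/Optimization]

Fourth file of the formalisation of the Charikar–Makarychev–Makarychev Sherali–Adams gap for
MAX-CUT (the tree's `CharikarMakarychevMakarychev2009_maxCutSA`).  The local `±1` processes of
CMM09 Cor. 5.1 / Thm 5.2 come from the multicut distributions of [CMM10, Thm 3.3] (= [CMM09,
Thm 2.4]) on `l`-path-decomposable graphs, constructed by induction along the decomposition
"one point union of subgraphs" / "a subgraph plus a path of length `l` attached at its endpoints"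
(CMM10 p. 15–18).  The proof of Thm 3.3 uses the following facts about walks, proved here once for
edge sets `A, B ⊆ Sym2 V` on a fixed finite vertex type (`gr A = fromEdgeSet A`; `supp A` = the
vertices covered by `A`):

* **one-point unions** (`supp A ∩ supp B ⊆ {c}`; CMM10 p. 17, case 2: "every simple path between
  them lies entirely in `C_i`", "each path between `u` and `v` must visit `c`"): every walk in
  `gr (A ∪ B)` is, up to shortening, an `A`-walk, a `B`-walk, or an `X`-walk to `c` followed by a
  `Y`-walk from `c` (`walk_onePointUnion`); hence the distance formulas `edist_onePointUnion_*` and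
  the reachability formula;
* **attached paths** (a path `a_0 … a_m` whose interior avoids `supp D`, and a subset `B` of its
  edges; CMM10 p. 18, case 3: "if `d_G(u,v) ≤ L` then `d_{H ∪ A₁ ∪ A₂}(u,v) = d_G(u,v)`", "Since
  `A₃` is always cut … `S` separates `u` and `v` in `G` iff … in `H ∪ A₁ ∪ A₂`"): a walk between
  non-interior vertices either stays in `D` up to shortening or traverses the whole path
  (`walk_attachedPath`), so distances between non-interior vertices in `gr (D ∪ B)` equal those in
  `gr D` when `B` misses a path edge, and are `≥ min(d_D, m)` in general; an interior segment
  between two missing path edges is closed (`reachable_closed`);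
* bridges/acyclicity bookkeeping for these unions (forests glued at one point are forests; a forest
  plus a cut attached path is a forest).

Pure finite graph theory over Mathlib's `SimpleGraph.Walk` / `edist` / `IsAcyclic`; everything is
proved, no named facts.

## References

* [CharikarMakarychevMakarychev2010] M. Charikar, K. Makarychev, Y. Makarychev, *Local global
  tradeoffs in metric embeddings*, SIAM J. Comput. 39 (2010) 2487–2512, doi:10.1137/070712080;
  Def. 3.2, Thm 3.3 and its proof, Lemma 3.4 (p. 15–18).  Held text `paper:doi-10-1137-070712080`.
* [CharikarMakarychevMakarychev2009] M. Charikar, K. Makarychev, Y. Makarychev, *Integrality gaps for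
  Sherali–Adams relaxations*, STOC 2009, doi:10.1145/1536414.1536455; Thm 2.4, Cor. 5.1 (p. 5, 8).
-/

noncomputable section

open Finset SimpleGraph

namespace Literature.Combinatorics.Optimization

namespace Multicut

variable {V : Type*} [DecidableEq V]

/-! ### Edge sets as graphs -/

/-- The simple graph of an edge set (loops discarded). [cite: CharikarMakarychevMakarychev2010, §3.1 (p. 15)] -/
abbrev gr (A : Finset (Sym2 V)) : SimpleGraph V := SimpleGraph.fromEdgeSet (A : Set (Sym2 V))

/-- The two endpoints of an unordered pair, as a finset. [folklore] -/
def verts (e : Sym2 V) : Finset V :=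
  Sym2.lift ⟨fun x y => ({x, y} : Finset V), fun x y => by simp [Finset.pair_comm]⟩ e

omit [DecidableEq V] in
/-- Membership in `verts`. [cite: CharikarMakarychevMakarychev2010, §3.1 (p. 15)] -/
theorem mem_verts [DecidableEq V] {e : Sym2 V} {v : V} : v ∈ verts e ↔ v ∈ e := by
  induction e using Sym2.ind with
  | h x y => simp [verts]

/-- The vertices covered by an edge set. [cite: CharikarMakarychevMakarychev2010, §3.1 (p. 15)] -/
def supp (A : Finset (Sym2 V)) : Finset V := A.biUnion verts

/-- Membership in the support. [cite: CharikarMakarychevMakarychev2010, §3.1 (p. 15)] -/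
theorem mem_supp {A : Finset (Sym2 V)} {v : V} : v ∈ supp A ↔ ∃ e ∈ A, v ∈ e := by
  simp [supp, mem_verts]

omit [DecidableEq V] in
/-- Adjacency in the graph of an edge set. [cite: CharikarMakarychevMakarychev2010, §3.1 (p. 15)] -/
theorem gr_adj {A : Finset (Sym2 V)} {v w : V} : (gr A).Adj v w ↔ s(v, w) ∈ A ∧ v ≠ w := by
  rw [fromEdgeSet_adj, mem_coe]

/-- The endpoints of an edge are in the support. [cite: CharikarMakarychevMakarychev2010, §3.1 (p. 15)] -/
theorem left_mem_supp {A : Finset (Sym2 V)} {v w : V} (h : s(v, w) ∈ A) : v ∈ supp A :=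
  mem_supp.2 ⟨_, h, Sym2.mem_mk_left _ _⟩

/-- The endpoints of an edge are in the support. [cite: CharikarMakarychevMakarychev2010, §3.1 (p. 15)] -/
theorem right_mem_supp {A : Finset (Sym2 V)} {v w : V} (h : s(v, w) ∈ A) : w ∈ supp A :=
  mem_supp.2 ⟨_, h, Sym2.mem_mk_right _ _⟩

/-- An adjacent vertex is in the support. [cite: CharikarMakarychevMakarychev2010, §3.1 (p. 15)] -/
theorem mem_supp_of_adj {A : Finset (Sym2 V)} {v w : V} (h : (gr A).Adj v w) : v ∈ supp A :=
  left_mem_supp (gr_adj.1 h).1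

/-- Supports are monotone. [cite: CharikarMakarychevMakarychev2010, §3.1 (p. 15)] -/
theorem supp_mono {A B : Finset (Sym2 V)} (h : A ⊆ B) : supp A ⊆ supp B := fun v hv => by
  obtain ⟨e, he, hve⟩ := mem_supp.1 hv
  exact mem_supp.2 ⟨e, h he, hve⟩

omit [DecidableEq V] in
/-- `gr` is monotone. [cite: CharikarMakarychevMakarychev2010, §3.1 (p. 15)] -/
theorem gr_mono {A B : Finset (Sym2 V)} (h : A ⊆ B) : gr A ≤ gr B :=
  fromEdgeSet_mono (coe_subset.2 h)

/-- A vertex outside the support is isolated: it reaches only itself.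
[cite: CharikarMakarychevMakarychev2010, §3.1 (p. 15)] -/
theorem eq_of_reachable_of_notMem_supp {A : Finset (Sym2 V)} {u v : V} (hu : u ∉ supp A)
    (h : (gr A).Reachable u v) : u = v := by
  obtain ⟨w⟩ := h
  cases w with
  | nil => rfl
  | cons hadj _ => exact absurd (mem_supp_of_adj hadj) hu

/-- A reachable vertex different from the start forces the start into the support.
[cite: CharikarMakarychevMakarychev2010, §3.1 (p. 15)] -/
theorem mem_supp_of_reachable_ne {A : Finset (Sym2 V)} {u v : V} (h : (gr A).Reachable u v)
    (hne : u ≠ v) : u ∈ supp A := by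
  by_contra hu
  exact hne (eq_of_reachable_of_notMem_supp hu h)

/-! ### Closed vertex sets -/

omit [DecidableEq V] in
/-- **A vertex set crossed by no edge is closed under reachability.**
[cite: CharikarMakarychevMakarychev2010, Thm 3.3 proof (p. 17–18)] -/
theorem reachable_closed {Z : Finset (Sym2 V)} {W : Set V}
    (hW : ∀ x y, s(x, y) ∈ Z → (x ∈ W ↔ y ∈ W)) {s t : V} (h : (gr Z).Reachable s t) :
    (s ∈ W ↔ t ∈ W) := by
  obtain ⟨w⟩ := h
  induction w with
  | nil => exact Iff.rfl
  | cons hadj _ ih => exact (hW _ _ (gr_adj.1 hadj).1).trans ih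

/-! ### One-point unions -/

section OnePoint

variable {A B : Finset (Sym2 V)} {c : V}

/-- **Walks in a one-point union decompose at the common vertex**: if the supports of `A` and `B`
meet at most in `c`, every walk `w` from `u` to `v` in `gr (A ∪ B)` can be shortened to an `A`-walk,
or a `B`-walk, or an `X`-walk from `u` to `c` followed by a `Y`-walk from `c` to `v`
(`X, Y ∈ {A, B}`), of total length `≤ |w|`.
[cite: CharikarMakarychevMakarychev2010, Thm 3.3 proof, case 2 (p. 17: "each path between u and v must visit c")] -/
theorem walk_onePointUnion (hAB : ∀ x, x ∈ supp A → x ∈ supp B → x = c) {u v : V}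
    (w : (gr (A ∪ B)).Walk u v) :
    (∃ w' : (gr A).Walk u v, w'.length ≤ w.length) ∨
    (∃ w' : (gr B).Walk u v, w'.length ≤ w.length) ∨
    (∃ (X Y : Finset (Sym2 V)), (X = A ∨ X = B) ∧ (Y = A ∨ Y = B) ∧
      ∃ (w₁ : (gr X).Walk u c) (w₂ : (gr Y).Walk c v), w₁.length + w₂.length ≤ w.length) := by
  induction w with
  | nil => exact Or.inl ⟨Walk.nil, le_rfl⟩
  | @cons x y z hadj w' ih =>
    have hxy : x ≠ y := hadj.ne
    have hmem : s(x, y) ∈ A ∨ s(x, y) ∈ B := by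
      simpa [mem_union] using (gr_adj.1 hadj).1
    rcases hmem with hA | hB
    · -- the new edge is an `A`-edge
      have hxA : (gr A).Adj x y := gr_adj.2 ⟨hA, hxy⟩
      have hyA : y ∈ supp A := right_mem_supp hA
      rcases ih with ⟨q, hq⟩ | ⟨q, hq⟩ | ⟨X, Y, hX, hY, q₁, q₂, hq⟩
      · exact Or.inl ⟨Walk.cons hxA q, by simp; omega⟩
      · -- `y` starts a `B`-walk: either it is trivial or `y = c`
        cases q with
        | nil => exact Or.inl ⟨Walk.cons hxA Walk.nil, by simp⟩
        | cons hadj' q' =>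
          have hyc : y = c := hAB y hyA (mem_supp_of_adj hadj')
          subst hyc
          refine Or.inr (Or.inr ⟨A, B, Or.inl rfl, Or.inr rfl, Walk.cons hxA Walk.nil,
            Walk.cons hadj' q', ?_⟩)
          simp at hq ⊢; omega
      · rcases hX with hX | hX
        · subst X
          exact Or.inr (Or.inr ⟨A, Y, Or.inl rfl, hY, Walk.cons hxA q₁, q₂, by simp; omega⟩)
        · subst X
          -- `q₁` is a `B`-walk from `y` to `c`: trivial or `y = c`
          have hyc : y = c := by
            cases q₁ with
            | nil => rfl
            | cons hadj' _ => exact hAB y hyA (mem_supp_of_adj hadj')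
          subst hyc
          exact Or.inr (Or.inr ⟨A, Y, Or.inl rfl, hY, Walk.cons hxA Walk.nil, q₂, by simp; omega⟩)
    · -- the new edge is a `B`-edge (symmetric)
      have hxB : (gr B).Adj x y := gr_adj.2 ⟨hB, hxy⟩
      have hyB : y ∈ supp B := right_mem_supp hB
      rcases ih with ⟨q, hq⟩ | ⟨q, hq⟩ | ⟨X, Y, hX, hY, q₁, q₂, hq⟩
      · cases q with
        | nil => exact Or.inr (Or.inl ⟨Walk.cons hxB Walk.nil, by simp⟩)
        | cons hadj' q' =>
          have hyc : y = c := hAB y (mem_supp_of_adj hadj') hyB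
          subst hyc
          refine Or.inr (Or.inr ⟨B, A, Or.inr rfl, Or.inl rfl, Walk.cons hxB Walk.nil,
            Walk.cons hadj' q', ?_⟩)
          simp at hq ⊢; omega
      · exact Or.inr (Or.inl ⟨Walk.cons hxB q, by simp; omega⟩)
      · rcases hX with hX | hX
        · subst X
          have hyc : y = c := by
            cases q₁ with
            | nil => rfl
            | cons hadj' _ => exact hAB y (mem_supp_of_adj hadj') hyB
          subst hyc
          exact Or.inr (Or.inr ⟨B, Y, Or.inr rfl, hY, Walk.cons hxB Walk.nil, q₂, by simp; omega⟩)
        · subst X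
          exact Or.inr (Or.inr ⟨B, Y, Or.inr rfl, hY, Walk.cons hxB q₁, q₂, by simp; omega⟩)

/-- **Distances in a one-point union, lower bound**: `d_{A∪B}(u,v)` is at least one of `d_A(u,v)`,
`d_B(u,v)`, `d_X(u,c) + d_Y(c,v)` (`X,Y ∈ {A,B}`).
[cite: CharikarMakarychevMakarychev2010, Thm 3.3 proof, case 2 (p. 17)] -/
theorem edist_onePointUnion_cases (hAB : ∀ x, x ∈ supp A → x ∈ supp B → x = c) (u v : V) :
    (gr A).edist u v ≤ (gr (A ∪ B)).edist u v ∨ (gr B).edist u v ≤ (gr (A ∪ B)).edist u v ∨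
    ∃ X Y : Finset (Sym2 V), (X = A ∨ X = B) ∧ (Y = A ∨ Y = B) ∧
      (gr X).edist u c + (gr Y).edist c v ≤ (gr (A ∪ B)).edist u v := by
  by_cases hr : (gr (A ∪ B)).Reachable u v
  · obtain ⟨w, hw⟩ := hr.exists_walk_length_eq_edist
    rcases walk_onePointUnion hAB w with ⟨q, hq⟩ | ⟨q, hq⟩ | ⟨X, Y, hX, hY, q₁, q₂, hq⟩
    · left; rw [← hw]; exact (edist_le q).trans (by exact_mod_cast hq)
    · right; left; rw [← hw]; exact (edist_le q).trans (by exact_mod_cast hq)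
    · right; right
      refine ⟨X, Y, hX, hY, ?_⟩
      rw [← hw]
      calc (gr X).edist u c + (gr Y).edist c v ≤ q₁.length + q₂.length :=
            add_le_add (edist_le q₁) (edist_le q₂)
        _ ≤ w.length := by exact_mod_cast hq
  · left
    rw [edist_eq_top_of_not_reachable hr]
    exact le_top

omit [DecidableEq V] in
/-- Distances only decrease when edges are added. [cite: CharikarMakarychevMakarychev2010, Thm 3.3 proof (p. 17)] -/
theorem edist_anti_of_subset {X Z : Finset (Sym2 V)} (h : X ⊆ Z) (u v : V) :
    (gr Z).edist u v ≤ (gr X).edist u v :=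
  edist_anti (gr_mono h)

/-- **Distances in a one-point union, upper bounds**: through `c`.
[cite: CharikarMakarychevMakarychev2010, Thm 3.3 proof, case 2 (p. 17)] -/
theorem edist_union_le_through {X Y : Finset (Sym2 V)} (hX : X ⊆ A ∪ B) (hY : Y ⊆ A ∪ B) (u v : V) :
    (gr (A ∪ B)).edist u v ≤ (gr X).edist u c + (gr Y).edist c v :=
  (SimpleGraph.edist_triangle (v := c)).trans
    (add_le_add (edist_anti_of_subset hX u c) (edist_anti_of_subset hY c v))

/-- **Reachability across a one-point union**: a vertex `u ∉ supp B`, `u ≠ c`, reaches `v ∈ supp B`,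
`v ≠ c`... more precisely: if `u` is isolated in `B` and `v` is isolated in `A` (and `u ≠ v`), then
`u, v` are joined in `A ∪ B` iff `u` is joined to `c` in `A` and `c` to `v` in `B`, and then
`d_{A∪B}(u,v) = d_A(u,c) + d_B(c,v)`.
[cite: CharikarMakarychevMakarychev2010, Thm 3.3 proof, case 2 (p. 17: "d(u,v) = d(u,c) + d(c,v)")] -/
theorem edist_onePointUnion_cross (hAB : ∀ x, x ∈ supp A → x ∈ supp B → x = c) {u v : V}
    (hu : u ∉ supp B) (hv : v ∉ supp A) (huv : u ≠ v) :
    (gr (A ∪ B)).edist u v = (gr A).edist u c + (gr B).edist c v := by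
  refine le_antisymm (edist_union_le_through subset_union_left subset_union_right u v) ?_
  rcases edist_onePointUnion_cases hAB u v with h | h | ⟨X, Y, hX, hY, h⟩
  · -- an `A`-walk from `u` to `v` forces `v = u` since `v` is isolated in `A`
    refine le_trans ?_ h
    by_cases hr : (gr A).Reachable u v
    · exact absurd (eq_of_reachable_of_notMem_supp hv hr.symm) (Ne.symm huv)
    · rw [edist_eq_top_of_not_reachable hr]; exact le_top
  · refine le_trans ?_ h
    by_cases hr : (gr B).Reachable u v
    · exact absurd (eq_of_reachable_of_notMem_supp hu hr) huv
    · rw [edist_eq_top_of_not_reachable hr]; exact le_top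
  · refine le_trans ?_ h
    -- a `B`-leg from `u` collapses (`u` isolated in `B`), an `A`-leg into `v` collapses
    have legX : (gr A).edist u c ≤ (gr X).edist u c := by
      rcases hX with hX | hX <;> rw [hX]
      by_cases hr : (gr B).Reachable u c
      · rw [eq_of_reachable_of_notMem_supp hu hr]; simp
      · rw [edist_eq_top_of_not_reachable hr]; exact le_top
    have legY : (gr B).edist c v ≤ (gr Y).edist c v := by
      rcases hY with hY | hY <;> rw [hY]
      by_cases hr : (gr A).Reachable c v
      · rw [← eq_of_reachable_of_notMem_supp hv hr.symm]; simp
      · rw [edist_eq_top_of_not_reachable hr]; exact le_top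
    exact add_le_add legX legY

/-- **Within one side of a one-point union distances do not change**: if `u, v` are isolated in
`B` then `d_{A∪B}(u,v) = d_A(u,v)`.
[cite: CharikarMakarychevMakarychev2010, Thm 3.3 proof, case 2 (p. 17: "every simple path between them lies entirely in C_i")] -/
theorem edist_onePointUnion_same (hAB : ∀ x, x ∈ supp A → x ∈ supp B → x = c) {u v : V}
    (hu : u ∉ supp B) (hv : v ∉ supp B) :
    (gr (A ∪ B)).edist u v = (gr A).edist u v := by
  refine le_antisymm (edist_anti_of_subset subset_union_left u v) ?_
  rcases edist_onePointUnion_cases hAB u v with h | h | ⟨X, Y, hX, hY, h⟩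
  · exact h
  · refine le_trans ?_ h
    by_cases hr : (gr B).Reachable u v
    · rw [eq_of_reachable_of_notMem_supp hu hr]; simp
    · rw [edist_eq_top_of_not_reachable hr]; exact le_top
  · refine le_trans ?_ h
    -- any `B`-leg from `u` to `c` or from `c` to `v` collapses (`u`,`v` isolated in `B`)
    have legX : (gr A).edist u c ≤ (gr X).edist u c := by
      rcases hX with hX | hX <;> rw [hX]
      by_cases hr : (gr B).Reachable u c
      · rw [eq_of_reachable_of_notMem_supp hu hr]; simp
      · rw [edist_eq_top_of_not_reachable hr]; exact le_top
    have legY : (gr A).edist c v ≤ (gr Y).edist c v := by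
      rcases hY with hY | hY <;> rw [hY]
      by_cases hr : (gr B).Reachable c v
      · rw [← eq_of_reachable_of_notMem_supp hv hr.symm]; simp
      · rw [edist_eq_top_of_not_reachable hr]; exact le_top
    exact (SimpleGraph.edist_triangle (v := c)).trans (add_le_add legX legY)

end OnePoint

/-! ### Acyclicity via bridges -/

/-- Deleting one edge of `gr Z` is `gr (Z.erase e)`. [cite: CharikarMakarychevMakarychev2010, Thm 3.3 (p. 16, condition 3)] -/
theorem deleteEdges_gr_singleton (Z : Finset (Sym2 V)) (e : Sym2 V) :
    (gr Z).deleteEdges {e} = gr (Z.erase e) := by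
  ext x y
  simp only [deleteEdges_adj, gr_adj, mem_erase, Set.mem_singleton_iff]
  tauto

/-- **Bridge criterion for forests of edge sets**: `gr Z` is acyclic iff no edge `{x,y} ∈ Z`
(`x ≠ y`) has its endpoints joined in `gr (Z ∖ {x,y})`.
[cite: CharikarMakarychevMakarychev2010, Thm 3.3 (p. 16, condition 3: "Every piece of the multicut partition is a tree")] -/
theorem isAcyclic_gr_iff (Z : Finset (Sym2 V)) :
    (gr Z).IsAcyclic ↔ ∀ x y, s(x, y) ∈ Z → x ≠ y → ¬ (gr (Z.erase s(x, y))).Reachable x y := by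
  rw [isAcyclic_iff_forall_adj_isBridge]
  constructor
  · intro h x y hxy hne
    have := h (gr_adj.2 ⟨hxy, hne⟩)
    rwa [isBridge_iff, deleteEdges_gr_singleton] at this
  · intro h x y hadj
    rw [isBridge_iff, deleteEdges_gr_singleton]
    exact h x y (gr_adj.1 hadj).1 (gr_adj.1 hadj).2

/-- The empty edge set is a forest. [cite: CharikarMakarychevMakarychev2010, Thm 3.3 proof, base case (p. 17)] -/
theorem isAcyclic_gr_empty : (gr (∅ : Finset (Sym2 V))).IsAcyclic :=
  (isAcyclic_gr_iff _).2 fun _ _ h => by simp at h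

/-- A single edge is a forest. [cite: CharikarMakarychevMakarychev2010, Thm 3.3 proof, base case (p. 17: "If G consists of two vertices connected by an edge")] -/
theorem isAcyclic_gr_singleton (e : Sym2 V) : (gr ({e} : Finset (Sym2 V))).IsAcyclic := by
  refine (isAcyclic_gr_iff _).2 fun x y hxy hne hr => hne ?_
  rw [mem_singleton] at hxy
  subst hxy
  refine eq_of_reachable_of_notMem_supp (A := ({s(x, y)} : Finset (Sym2 V)).erase s(x, y)) ?_ hr
  simp [mem_supp]

section OnePointForest

variable {A B : Finset (Sym2 V)} {c : V}

/-- **Forests glued at one point form a forest.**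
[cite: CharikarMakarychevMakarychev2010, Thm 3.3 proof, case 2 (p. 18: "since each piece of every multicut partition S_i is a tree, every piece of S is also a tree")] -/
theorem isAcyclic_onePointUnion (hAB : ∀ x, x ∈ supp A → x ∈ supp B → x = c)
    (hA : (gr A).IsAcyclic) (hB : (gr B).IsAcyclic) : (gr (A ∪ B)).IsAcyclic := by
  -- symmetric core: an `A`-edge stays a bridge in the union
  have core : ∀ (A B : Finset (Sym2 V)), (∀ x, x ∈ supp A → x ∈ supp B → x = c) →
      (gr A).IsAcyclic → ∀ x y, s(x, y) ∈ A → x ≠ y →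
      ¬ (gr ((A ∪ B).erase s(x, y))).Reachable x y := by
    intro A B hAB hA x y hxy hne hr
    have hbridge := (isAcyclic_gr_iff A).1 hA x y hxy hne
    have hxA : x ∈ supp A := left_mem_supp hxy
    have hyA : y ∈ supp A := right_mem_supp hxy
    -- the edge is not a `B`-edge, so erasing commutes with the union
    have heB : s(x, y) ∉ B := fun h =>
      hne ((hAB x hxA (left_mem_supp h)).trans (hAB y hyA (right_mem_supp h)).symm)
    have hset : (A ∪ B).erase s(x, y) = A.erase s(x, y) ∪ B := by
      ext e
      simp only [mem_erase, mem_union]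
      constructor
      · rintro ⟨hne', h | h⟩
        · exact Or.inl ⟨hne', h⟩
        · exact Or.inr h
      · rintro (⟨hne', h⟩ | h)
        · exact ⟨hne', Or.inl h⟩
        · exact ⟨by rintro rfl; exact heB h, Or.inr h⟩
    rw [hset] at hr
    have hAB' : ∀ t, t ∈ supp (A.erase s(x, y)) → t ∈ supp B → t = c :=
      fun t ht htB => hAB t (supp_mono (erase_subset _ _) ht) htB
    -- `x` or `y` is not the gluing point, hence isolated in `B`
    have iso : ∀ t, t ∈ supp A → t ≠ c → t ∉ supp B := fun t ht htc htB => htc (hAB t ht htB)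
    obtain ⟨w⟩ := hr
    rcases walk_onePointUnion hAB' w with ⟨q, _⟩ | ⟨q, _⟩ | ⟨X, Y, hX, hY, q₁, q₂, _⟩
    · exact hbridge ⟨q⟩
    · -- a `B`-walk between `x` and `y`: impossible
      by_cases hxc : x = c
      · have hyc : y ≠ c := fun h => hne (hxc.trans h.symm)
        exact hyc ((eq_of_reachable_of_notMem_supp (iso y hyA hyc) ⟨q.reverse⟩).trans hxc)
      · exact hne (eq_of_reachable_of_notMem_supp (iso x hxA hxc) ⟨q⟩)
    · -- through `c`
      have legX : (gr (A.erase s(x, y))).Reachable x c := by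
        rcases hX with hX | hX <;> subst X
        · exact ⟨q₁⟩
        · by_cases hxc : x = c
          · subst hxc; exact Reachable.refl _
          · exact absurd (eq_of_reachable_of_notMem_supp (iso x hxA hxc) ⟨q₁⟩) hxc
      have legY : (gr (A.erase s(x, y))).Reachable c y := by
        rcases hY with hY | hY <;> subst Y
        · exact ⟨q₂⟩
        · by_cases hyc : y = c
          · subst hyc; exact Reachable.refl _
          · exact absurd (eq_of_reachable_of_notMem_supp (iso y hyA hyc) ⟨q₂.reverse⟩) hyc
      exact hbridge (legX.trans legY)
  refine (isAcyclic_gr_iff _).2 fun x y hxy hne => ?_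
  rcases mem_union.1 hxy with h | h
  · exact core A B hAB hA x y h hne
  · have hBA : ∀ x, x ∈ supp B → x ∈ supp A → x = c := fun x hB' hA' => hAB x hA' hB'
    rw [union_comm]
    exact core B A hBA hB x y h hne

end OnePointForest

/-! ### Attached paths -/

section AttachedPath

variable {D B : Finset (Sym2 V)} {a : ℕ → V} {m : ℕ}

/-- The edge set of the path `a_0 a_1 ⋯ a_m`. [cite: CharikarMakarychevMakarychev2010, Thm 3.3 proof, case 3 (p. 18)] -/
def pathEdges (a : ℕ → V) (m : ℕ) : Finset (Sym2 V) := (range m).image fun k => s(a k, a (k + 1))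

/-- Membership in `pathEdges`. [cite: CharikarMakarychevMakarychev2010, Thm 3.3 proof, case 3 (p. 18)] -/
theorem mem_pathEdges {e : Sym2 V} : e ∈ pathEdges a m ↔ ∃ k < m, s(a k, a (k + 1)) = e := by
  simp [pathEdges]

/-- The `k`-th edge is a path edge. [cite: CharikarMakarychevMakarychev2010, Thm 3.3 proof, case 3 (p. 18)] -/
theorem edge_mem_pathEdges {k : ℕ} (hk : k < m) : s(a k, a (k + 1)) ∈ pathEdges a m :=
  mem_pathEdges.2 ⟨k, hk, rfl⟩

/-- "All path edges before position `k` lie in `B`." [cite: CharikarMakarychevMakarychev2010, Thm 3.3 proof, case 3 (p. 18)] -/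
def Pre (B : Finset (Sym2 V)) (a : ℕ → V) (k : ℕ) : Prop := ∀ j < k, s(a j, a (j + 1)) ∈ B

/-- "All path edges from position `k` on lie in `B`." [cite: CharikarMakarychevMakarychev2010, Thm 3.3 proof, case 3 (p. 18)] -/
def Suf (B : Finset (Sym2 V)) (a : ℕ → V) (m k : ℕ) : Prop := ∀ j, k ≤ j → j < m → s(a j, a (j + 1)) ∈ B

/-- A subset of the path edges containing a prefix up to `k` and the suffix from `k` is everything.
[cite: CharikarMakarychevMakarychev2010, Thm 3.3 proof, case 3 (p. 18)] -/
theorem eq_pathEdges_of_pre_suf (hB : B ⊆ pathEdges a m) {k : ℕ} (h₁ : Pre B a k) (h₂ : Suf B a m k) :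
    B = pathEdges a m := by
  refine Subset.antisymm hB fun e he => ?_
  obtain ⟨j, hj, rfl⟩ := mem_pathEdges.1 he
  by_cases hjk : j < k
  · exact h₁ j hjk
  · exact h₂ j (not_lt.1 hjk) hj

/-- **Walks along an attached path** (the potential argument).  Let `a_0,…,a_m` (`m ≥ 2`) be
injective, let the interior vertices `a_1,…,a_{m−1}` avoid `supp D`, and let `B ⊆` the path edges.
For a target `v` that is not interior and any walk `w` from `u` to `v` in `gr (D ∪ B)`:
(i) if `u` is not interior, then either some `D`-walk from `u` to `v` is no longer than `w`, or `B`
is the whole path and `|w| ≥ m`; (ii) if `u = a_k` is interior, then either the prefix up to `k`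
lies in `B` and some `D`-walk from `a_0` to `v` has length `≤ |w| − k`, or the suffix from `k` lies
in `B` and some `D`-walk from `a_m` to `v` has length `≤ |w| − (m − k)`, or `B` is the whole path
and `|w| ≥ m`.
[cite: CharikarMakarychevMakarychev2010, Thm 3.3 proof, case 3 (p. 18)] -/
theorem walk_attachedPath (ha : ∀ i j, i ≤ m → j ≤ m → a i = a j → i = j)
    (hD : ∀ k, 0 < k → k < m → a k ∉ supp D) (hB : B ⊆ pathEdges a m) (hm : 2 ≤ m)
    {v : V} (hv : ∀ k, 0 < k → k < m → a k ≠ v) {u : V} (w : (gr (D ∪ B)).Walk u v) :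
    ((∀ k, 0 < k → k < m → a k ≠ u) →
      (∃ w' : (gr D).Walk u v, w'.length ≤ w.length) ∨ (B = pathEdges a m ∧ m ≤ w.length)) ∧
    (∀ k, 0 < k → k < m → a k = u →
      (Pre B a k ∧ ∃ w' : (gr D).Walk (a 0) v, k + w'.length ≤ w.length) ∨
      (Suf B a m k ∧ ∃ w' : (gr D).Walk (a m) v, (m - k) + w'.length ≤ w.length) ∨
      (B = pathEdges a m ∧ m ≤ w.length)) := by
  induction w with
  | nil =>
    exact ⟨fun _ => Or.inl ⟨Walk.nil, le_rfl⟩, fun k hk hkm hku => absurd hku (hv k hk hkm)⟩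
  | @cons x y z hadj w' ih =>
    have hxy : x ≠ y := hadj.ne
    have hmem : s(x, y) ∈ D ∨ s(x, y) ∈ B := by simpa [mem_union] using (gr_adj.1 hadj).1
    rcases hmem with hDe | hBe
    · -- a `D`-edge: both endpoints are non-interior
      have hxD : (gr D).Adj x y := gr_adj.2 ⟨hDe, hxy⟩
      have hyni : ∀ k, 0 < k → k < m → a k ≠ y := fun k hk hkm hky =>
        hD k hk hkm (hky ▸ right_mem_supp hDe)
      have hxni : ∀ k, 0 < k → k < m → a k ≠ x := fun k hk hkm hkx =>
        hD k hk hkm (hkx ▸ left_mem_supp hDe)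
      refine ⟨fun _ => ?_, fun k hk hkm hkx => absurd hkx (hxni k hk hkm)⟩
      rcases (ih hv).1 hyni with ⟨q, hq⟩ | ⟨hfull, hle⟩
      · exact Or.inl ⟨Walk.cons hxD q, by simp; omega⟩
      · exact Or.inr ⟨hfull, by simp; omega⟩
    · -- a path edge `{a k, a (k+1)}`
      obtain ⟨k, hkm, hke⟩ := mem_pathEdges.1 (hB hBe)
      have hlen : (Walk.cons hadj w').length = w'.length + 1 := by simp
      rw [hlen]
      rcases Sym2.eq_iff.1 hke with ⟨hkx, hky⟩ | ⟨hkx, hky⟩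
      · -- ascending: `x = a k`, `y = a (k+1)`
        subst hkx; subst hky
        by_cases hk0 : k = 0
        · -- `x = a 0` (not interior); `y = a 1` is interior
          subst hk0
          refine ⟨fun _ => ?_, fun k' hk' hk'm hk'x => ?_⟩
          · rcases (ih hv).2 1 one_pos (by omega) rfl with ⟨-, q, hq⟩ | ⟨hsuf, q, hq⟩ | ⟨hfull, hle⟩
            · exact Or.inl ⟨q, by omega⟩
            · have hfull : B = pathEdges a m :=
                eq_pathEdges_of_pre_suf hB (k := 1) (fun j hj => by
                  have : j = 0 := by omega
                  subst this; exact hBe) hsuf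
              exact Or.inr ⟨hfull, by omega⟩
            · exact Or.inr ⟨hfull, by omega⟩
          · exact absurd (ha k' 0 hk'm.le (by omega) hk'x) (by omega)
        · have hkpos : 0 < k := Nat.pos_of_ne_zero hk0
          refine ⟨fun hx => absurd rfl (hx k hkpos hkm), fun k' hk' hk'm hk'x => ?_⟩
          have hkk : k' = k := ha k' k hk'm.le hkm.le hk'x
          subst hkk
          by_cases hk1 : k' + 1 < m
          · rcases (ih hv).2 (k' + 1) (by omega) hk1 rfl with
              ⟨hpre, q, hq⟩ | ⟨hsuf, q, hq⟩ | ⟨hfull, hle⟩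
            · exact Or.inl ⟨fun j hj => hpre j (by omega), q, by omega⟩
            · refine Or.inr (Or.inl ⟨fun j hj hjm => ?_, q, by omega⟩)
              by_cases hjk : j = k'
              · subst hjk; exact hBe
              · exact hsuf j (by omega) hjm
            · exact Or.inr (Or.inr ⟨hfull, by omega⟩)
          · -- `y = a m`
            have hkm1 : k' + 1 = m := by omega
            have hyni : ∀ j, 0 < j → j < m → a j ≠ a (k' + 1) := fun j hj hjm hja =>
              absurd (ha j (k' + 1) hjm.le (by omega) hja) (by omega)
            rcases (ih hv).1 hyni with ⟨q, hq⟩ | ⟨hfull, hle⟩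
            · refine Or.inr (Or.inl ⟨fun j hj hjm => ?_, ?_⟩)
              · have : j = k' := by omega
                subst this; exact hBe
              · subst hkm1
                exact ⟨q, by omega⟩
            · exact Or.inr (Or.inr ⟨hfull, by omega⟩)
      · -- descending: `x = a (k+1)`, `y = a k`
        subst hkx; subst hky
        by_cases hk1 : k + 1 = m
        · -- `x = a m` (not interior); `y = a (m-1)` interior
          refine ⟨fun _ => ?_, fun k' hk' hk'm hk'x => ?_⟩
          · rcases (ih hv).2 k (by omega) hkm rfl with ⟨hpre, q, hq⟩ | ⟨-, q, hq⟩ | ⟨hfull, hle⟩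
            · have hfull : B = pathEdges a m :=
                eq_pathEdges_of_pre_suf hB (k := k + 1) (fun j hj => by
                  by_cases hjk : j = k
                  · subst hjk; rw [Sym2.eq_swap]; exact hBe
                  · exact hpre j (by omega)) (fun j hj hjm => by omega)
              exact Or.inr ⟨hfull, by omega⟩
            · subst hk1
              exact Or.inl ⟨q, by omega⟩
            · exact Or.inr ⟨hfull, by omega⟩
          · exact absurd (ha k' (k + 1) hk'm.le (by omega) hk'x) (by omega)
        · have hk1' : k + 1 < m := by omega
          refine ⟨fun hx => absurd rfl (hx (k + 1) (by omega) hk1'), fun k' hk' hk'm hk'x => ?_⟩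
          have hkk : k' = k + 1 := ha k' (k + 1) hk'm.le hk1'.le hk'x
          subst hkk
          by_cases hk0 : k = 0
          · -- `y = a 0`
            subst hk0
            have hyni : ∀ j, 0 < j → j < m → a j ≠ a 0 := fun j hj hjm hja =>
              absurd (ha j 0 hjm.le (by omega) hja) (by omega)
            rcases (ih hv).1 hyni with ⟨q, hq⟩ | ⟨hfull, hle⟩
            · refine Or.inl ⟨fun j hj => ?_, q, by omega⟩
              have : j = 0 := by omega
              subst this; rw [Sym2.eq_swap]; exact hBe
            · exact Or.inr (Or.inr ⟨hfull, by omega⟩)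
          · rcases (ih hv).2 k (Nat.pos_of_ne_zero hk0) hkm rfl with
              ⟨hpre, q, hq⟩ | ⟨hsuf, q, hq⟩ | ⟨hfull, hle⟩
            · refine Or.inl ⟨fun j hj => ?_, q, by omega⟩
              by_cases hjk : j = k
              · subst hjk; rw [Sym2.eq_swap]; exact hBe
              · exact hpre j (by omega)
            · exact Or.inr (Or.inl ⟨fun j hj hjm => hsuf j (by omega) hjm, q, by omega⟩)
            · exact Or.inr (Or.inr ⟨hfull, by omega⟩)

/-- **Distances between non-interior vertices along an attached path**: they can only shrink
below the `D`-distance by traversing the whole path, i.e. `min(d_D(u,v), m) ≤ d_{D∪B}(u,v)`.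
[cite: CharikarMakarychevMakarychev2010, Thm 3.3 proof, case 3 (p. 18: "if d_G(u,v) ≤ L then d_{H∪A_1∪A_2}(u,v) = d_G(u,v)")] -/
theorem min_edist_le_edist_attachedPath (ha : ∀ i j, i ≤ m → j ≤ m → a i = a j → i = j)
    (hD : ∀ k, 0 < k → k < m → a k ∉ supp D) (hB : B ⊆ pathEdges a m) (hm : 2 ≤ m)
    {u v : V} (hu : ∀ k, 0 < k → k < m → a k ≠ u) (hv : ∀ k, 0 < k → k < m → a k ≠ v) :
    min ((gr D).edist u v) m ≤ (gr (D ∪ B)).edist u v := by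
  by_cases hr : (gr (D ∪ B)).Reachable u v
  · obtain ⟨w, hw⟩ := hr.exists_walk_length_eq_edist
    rw [← hw]
    rcases (walk_attachedPath ha hD hB hm hv w).1 hu with ⟨q, hq⟩ | ⟨-, hle⟩
    · exact (min_le_left _ _).trans ((edist_le q).trans (by exact_mod_cast hq))
    · exact (min_le_right _ _).trans (by exact_mod_cast hle)
  · rw [edist_eq_top_of_not_reachable hr]; exact le_top

/-- **If the attached path misses an edge it does not change distances between non-interior
vertices**: `d_{D∪B}(u,v) = d_D(u,v)` when `B ⊊` path edges.
[cite: CharikarMakarychevMakarychev2010, Thm 3.3 proof, case 3 (p. 18: "Since A_3 is always cut by S, the multicut S separates u and v in G if and only if … in H∪A_1∪A_2")] -/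
theorem edist_attachedPath_of_ne (ha : ∀ i j, i ≤ m → j ≤ m → a i = a j → i = j)
    (hD : ∀ k, 0 < k → k < m → a k ∉ supp D) (hB : B ⊆ pathEdges a m) (hBne : B ≠ pathEdges a m)
    (hm : 2 ≤ m) {u v : V} (hu : ∀ k, 0 < k → k < m → a k ≠ u) (hv : ∀ k, 0 < k → k < m → a k ≠ v) :
    (gr (D ∪ B)).edist u v = (gr D).edist u v := by
  refine le_antisymm (edist_anti_of_subset subset_union_left u v) ?_
  by_cases hr : (gr (D ∪ B)).Reachable u v
  · obtain ⟨w, hw⟩ := hr.exists_walk_length_eq_edist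
    rw [← hw]
    rcases (walk_attachedPath ha hD hB hm hv w).1 hu with ⟨q, hq⟩ | ⟨hfull, -⟩
    · exact (edist_le q).trans (by exact_mod_cast hq)
    · exact absurd hfull hBne
  · rw [edist_eq_top_of_not_reachable hr]; exact le_top

/-- Reachability form of `edist_attachedPath_of_ne`. [cite: CharikarMakarychevMakarychev2010, Thm 3.3 proof, case 3 (p. 18)] -/
theorem reachable_attachedPath_iff_of_ne (ha : ∀ i j, i ≤ m → j ≤ m → a i = a j → i = j)
    (hD : ∀ k, 0 < k → k < m → a k ∉ supp D) (hB : B ⊆ pathEdges a m) (hBne : B ≠ pathEdges a m)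
    (hm : 2 ≤ m) {u v : V} (hu : ∀ k, 0 < k → k < m → a k ≠ u) (hv : ∀ k, 0 < k → k < m → a k ≠ v) :
    (gr (D ∪ B)).Reachable u v ↔ (gr D).Reachable u v := by
  rw [← edist_ne_top_iff_reachable, ← edist_ne_top_iff_reachable,
    edist_attachedPath_of_ne ha hD hB hBne hm hu hv]

/-- Every path edge has an interior endpoint (`m ≥ 2`), so it is not a `D`-edge.
[cite: CharikarMakarychevMakarychev2010, Thm 3.3 proof, case 3 (p. 18)] -/
theorem pathEdge_notMem (hD : ∀ k, 0 < k → k < m → a k ∉ supp D) (hm : 2 ≤ m) {k : ℕ}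
    (hk : k < m) : s(a k, a (k + 1)) ∉ D := by
  intro h
  by_cases hk0 : k = 0
  · subst hk0
    exact hD 1 one_pos (by omega) (right_mem_supp h)
  · exact hD k (Nat.pos_of_ne_zero hk0) hk (left_mem_supp h)

/-- **A forest with a cut path attached along its endpoints is a forest**: if `gr D` is acyclic,
the interior of the path avoids `supp D`, and `B` is a proper subset of the path edges, then
`gr (D ∪ B)` is acyclic.
[cite: CharikarMakarychevMakarychev2010, Thm 3.3 proof, case 3 (p. 18: "every cycle in H is cut by the multicut … and the path P is cut by the multicut. Therefore, every piece … is a tree")] -/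
theorem isAcyclic_attachedPath (ha : ∀ i j, i ≤ m → j ≤ m → a i = a j → i = j)
    (hD : ∀ k, 0 < k → k < m → a k ∉ supp D) (hB : B ⊆ pathEdges a m) (hBne : B ≠ pathEdges a m)
    (hm : 2 ≤ m) (hDac : (gr D).IsAcyclic) : (gr (D ∪ B)).IsAcyclic := by
  refine (isAcyclic_gr_iff _).2 fun x y hxy hne hr => ?_
  rcases mem_union.1 hxy with hDe | hBe
  · -- a `D`-edge: erase it inside `D`; the attached path does not help
    have hxni : ∀ k, 0 < k → k < m → a k ≠ x := fun k hk hkm hkx =>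
      hD k hk hkm (hkx ▸ left_mem_supp hDe)
    have hyni : ∀ k, 0 < k → k < m → a k ≠ y := fun k hk hkm hky =>
      hD k hk hkm (hky ▸ right_mem_supp hDe)
    have hsub : (D ∪ B).erase s(x, y) ⊆ D.erase s(x, y) ∪ B := by
      intro e he
      rw [mem_erase, mem_union] at he
      rw [mem_union, mem_erase]
      tauto
    have hD' : ∀ k, 0 < k → k < m → a k ∉ supp (D.erase s(x, y)) := fun k hk hkm h =>
      hD k hk hkm (supp_mono (erase_subset _ _) h)
    have hr' : (gr (D.erase s(x, y) ∪ B)).Reachable x y := hr.mono (gr_mono hsub)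
    rw [reachable_attachedPath_iff_of_ne ha hD' hB hBne hm hxni hyni] at hr'
    exact (isAcyclic_gr_iff D).1 hDac x y hDe hne hr'
  · -- a path edge `{a j, a (j+1)}`: the segment up to a missing edge is closed
    obtain ⟨j, hjm, hje⟩ := mem_pathEdges.1 (hB hBe)
    -- a missing path edge
    obtain ⟨e', he', he'B⟩ : ∃ e' ∈ pathEdges a m, e' ∉ B := by
      by_contra hcon
      push Not at hcon
      exact hBne (Subset.antisymm hB hcon)
    obtain ⟨j', hj'm, rfl⟩ := mem_pathEdges.1 he'
    have hjj : j' ≠ j := by rintro rfl; exact he'B (hje ▸ hBe)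
    -- the closed segment `W = a(lo, hi]`
    set lo := min j j' with hlo
    set hi := max j j' with hhi
    let W : Set V := {z | ∃ i, lo < i ∧ i ≤ hi ∧ a i = z}
    have hhim : hi < m := max_lt hjm hj'm
    have memW : ∀ i, i ≤ m → (a i ∈ W ↔ lo < i ∧ i ≤ hi) := by
      intro i hi0
      constructor
      · rintro ⟨i', h1, h2, h3⟩
        have := ha i' i (by omega) hi0 h3
        subst this; exact ⟨h1, h2⟩
      · intro h; exact ⟨i, h.1, h.2, rfl⟩
    have hclosed : ∀ p q, s(p, q) ∈ (D ∪ B).erase s(x, y) → (p ∈ W ↔ q ∈ W) := by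
      intro p q hpq
      rw [mem_erase, mem_union] at hpq
      rcases hpq.2 with hpD | hpB
      · -- `D`-edges avoid the interior, hence `W`
        have hp : p ∉ W := by
          rintro ⟨i, h1, h2, h3⟩
          exact hD i (by omega) (by omega) (h3 ▸ left_mem_supp hpD)
        have hq : q ∉ W := by
          rintro ⟨i, h1, h2, h3⟩
          exact hD i (by omega) (by omega) (h3 ▸ right_mem_supp hpD)
        simp [hp, hq]
      · obtain ⟨i, him, hie⟩ := mem_pathEdges.1 (hB hpB)
        have hi_ne_j : i ≠ j := by
          rintro rfl; exact hpq.1 (hie.symm.trans hje)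
        have hi_ne_j' : i ≠ j' := by
          rintro rfl; exact he'B (by rw [hie]; exact hpB)
        -- both endpoints `a i`, `a (i+1)` are on the same side of `W`
        have key : (a i ∈ W ↔ a (i + 1) ∈ W) := by
          rw [memW i him.le, memW (i + 1) (by omega)]
          omega
        rcases Sym2.eq_iff.1 hie with ⟨rfl, rfl⟩ | ⟨rfl, rfl⟩
        · exact key
        · exact key.symm
    have hxyW := reachable_closed hclosed hr
    -- but the erased edge `{a j, a (j+1)}` crosses `W`
    have cross : ¬ (a j ∈ W ↔ a (j + 1) ∈ W) := by
      rw [memW j hjm.le, memW (j + 1) (by omega)]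
      omega
    rcases Sym2.eq_iff.1 hje with ⟨rfl, rfl⟩ | ⟨rfl, rfl⟩
    · exact cross hxyW
    · exact cross hxyW.symm

end AttachedPath

end Multicut

end Literature.Combinatorics.Optimization

end
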